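import Literature.Topology.FourManifolds.CappellShanesonClassGroupFifteen
import Literature.Topology.FourManifolds.CappellShanesonIdealCertificates
import HarnessLib

/-!
# The class group of the trace `17` field (discriminant `42817 = 47 · 911`) and Gompf's conjecture
# for the traces `17` and `-12` (Kim–Yamada 2023, Theorem B)

Serves the named fact
`Literature.Topology.FourManifolds.kimYamada2023_nonempty_diffeomorph_sphere_four_of_trace_mem_Icc`
(`CappellShaneson.lean`; M. H. Kim, S. Yamada, Kyungpook Math. J. 63 (2023) 373–411 =
arXiv:1707.03860, Cor. C), reduced in the tree to Gompf's topological leaves and Theorem B in matrix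
form (`GompfConjectureForTrace n`) for the traces not yet proved. Like its siblings for the traces
`12`, `14`, `15`, `16`, this file PROVES Theorem B for the trace `17` — `C(ℤ[Θ₁₇])` is covered by
the representatives `(1, 1, 17)`, `(4, 5, 17)`, `(6, 7, 17)`, which move by Gompf moves to the traces
`17`, `7 = 17 - 2·5`, `3 = 17 - 2·7` (Lemma 6.1 / §6.1), where Gompf's conjecture holds — and, by
Theorem A, for `-12 = 5 - 17`.

## The number theory

For a cubic number field `K` generated by a root `θ` of `f₁₇ = x³ - 17x² + 16x - 1`:

* `Δ(f₁₇) = 42817 = 47 · 911` is squarefree, so `𝓞 K = ℤ[θ]`, `d_K = 42817`, `⌊M_K⌋ ≤ 58`;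
* Dedekind–Kummer at `p ≤ 58` (Marcus, Ch. 3, Thm. 27): `2, 3, 11, 53` are inert;
  `f₁₇ ≡ (x - 4)(x² + 2x + 4) (mod 5)`, `f₁₇ ≡ (x - 6)(x² + 3x + 6) (mod 7)` (linear times
  irreducible quadratic); unique roots `5, 5, 11, 12, 20, 31, 19, 6` modulo
  `13, 17, 19, 23, 31, 37, 41, 43`; `f₁₇ ≡ (x - 2)(x - 4)(x - 11) (mod 29)` splits; and
  `f₁₇ ≡ (x - 18)²(x - 28) (mod 47)` (`47 ∣ Δ` ramifies);
* relations with explicit cofactors: `𝔭₅² = (25, θ - 19)` and `𝔭₅ (25, θ - 19) = (4θ - 1)` (norm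
  `125`), so `[𝔭₅]³ = 1`; `𝔭₅ 𝔮₂₅ = (5)`, `𝔭₅ 𝔭₇ = (θ + 1)` (`35`), `𝔭₇ 𝔮₄₉ = (7)`,
  `𝔭₅ 𝔭₁₃ = (3θ - 2)` (`65`), `𝔭₇ 𝔭₁₇ = (4θ - 3)` (`119`), `𝔭₅ 𝔭₁₉ = (2θ - 3)` (`95`),
  `𝔭₂₃ = (2θ - 1)` (`23`), `(29, θ - 2) = (θ - 2)` (`29`), `𝔭₅ (29, θ - 4) = (θ - 4)` (`145`),
  `𝔭₇ (29, θ - 11) = (3θ - 4)` (`203`), `𝔭₅ 𝔭₃₁ = (θ² - 3θ + 1)` (`155`), `𝔭₇ 𝔭₃₇ = (6θ - 1)` (`259`),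
  `𝔭₇ 𝔭₄₁ = (θ² - 4θ + 2)` (`287`), `𝔭₇ 𝔭₄₃ = (θ - 6)` (`301`), `𝔭₁₃ (47, θ - 18) = (θ - 18)`
  (`611`), `𝔭₃₁ (47, θ - 28) = (2θ - 9)` (`1457`);
* hence every ideal class is `1`, `[𝔭₅]` or `[𝔭₇] = [𝔭₅]⁻¹` (`classGroup_mem_triple_seventeen`).

Transport to `ℤ[X]/(f₁₇)` and Prop. 2.14 (`exists_isConj_standardCSMatrix_of_cover`):
`isConj_standardCSMatrix_of_trace_eq_seventeen`, `gompfConjectureForTrace_seventeen`,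
`gompfConjectureForTrace_neg_twelve`. No named fact is introduced (D-0026).

## References

* [KimYamada2023] M. H. Kim, S. Yamada, Kyungpook Math. J. 63 (2023) 373–411 (arXiv:1707.03860):
  §2.3 (Prop. 2.14), §5 (Table 2), §6.1 (Lemma 6.1 and the proof of Thm. B), Thm. A.
* [Marcus2018] D. A. Marcus, *Number Fields*, 2nd ed., Ch. 3, Thm. 27 (Dedekind–Kummer); Ch. 5,
  Cor. 2 of Thm. 37 (Minkowski bound).
-/

noncomputable section

open Set Polynomial Module NumberField Ideal
open scoped NumberField MatrixGroups nonZeroDivisors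
open Literature.LinearAlgebra.Matrix

namespace Literature.Topology.FourManifolds


section Field

variable {K : Type*} [Field K] [NumberField K] {θ : K}

/-! ### Discriminant `42817` and `𝓞 K = ℤ[θ]` -/

/-- `Δ(f₁₇) = 17·15·14·12 - 23 = 42817`. [cite: KimYamada2023, §3 (Δ(fₙ) = n(n-2)(n-3)(n-5) - 23)] -/
theorem csDisc_seventeen : csDisc 17 = 42817 := by
  decide

set_option maxRecDepth 8192 in
/-- `42817 = 47 · 911` is squarefree, so `Δ(f₁₇)` has no factorisation `r² e` with `|e| > 2`,
`r ≠ ±1`, and `𝓞 K = ℤ[θ]`. [folklore] -/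
theorem csDisc_seventeen_sq : ∀ r e : ℤ, csDisc 17 = r ^ 2 * e → 2 < |e| → IsUnit r :=
  isUnit_of_eq_sq_mul (B := 206) (by decide) (by decide) (by decide)

/-- `d_K = 42817` for the trace `17` field. [folklore] -/
theorem discr_eq_seventeen (hθ : aeval θ (csPoly 17) = 0) (h3 : finrank ℚ K = 3) :
    NumberField.discr K = 42817 := by
  rw [discr_eq_csDisc_of_sq hθ h3 csDisc_seventeen_sq, csDisc_seventeen]

/-- The cubic relation `θ³ - 17θ² + 16θ - 1 = 0` in `𝓞 K`. [folklore] -/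
theorem thetaInt_rel_seventeen (hθ : aeval θ (csPoly 17) = 0) :
    (thetaInt hθ) ^ 3 - 17 * (thetaInt hθ) ^ 2 + 16 * thetaInt hθ - 1 = 0 := by
  have rel := thetaInt_rel hθ
  push_cast at rel
  linear_combination rel

/-! ### The primes of norm at most `58` (Dedekind–Kummer) -/

set_option maxRecDepth 16384 in
/-- The inert primes `2, 3, 11, 53` (no root of `f₁₇`): every prime above them is `(p)`. [folklore] -/
theorem eq_span_of_inert_seventeen (hθ : aeval θ (csPoly 17) = 0) (h3 : finrank ℚ K = 3) {p : ℕ}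
    (hp : p = 2 ∨ p = 3 ∨ p = 11 ∨ p = 53)
    {P : Ideal (𝓞 K)} (hP : P ∈ primesOver (span {(p : ℤ)}) (𝓞 K)) : P = span {(p : 𝓞 K)} := by
  rcases hp with rfl | rfl | rfl | rfl
  · exact eq_span_of_no_root_of_sq hθ h3 csDisc_seventeen_sq (by norm_num) hP (by decide)
  · exact eq_span_of_no_root_of_sq hθ h3 csDisc_seventeen_sq (by norm_num) hP (by decide)
  · exact eq_span_of_no_root_of_sq hθ h3 csDisc_seventeen_sq (by norm_num) hP (by decide)
  · exact eq_span_of_no_root_of_sq hθ h3 csDisc_seventeen_sq (by norm_num) hP (by decide)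

set_option maxRecDepth 16384 in
/-- The degree-one primes at primes with a unique root of `f₁₇`: `(13, θ - 5)`, `(17, θ - 5)`, `(19, θ - 11)`, `(23, θ - 12)`, `(31, θ - 20)`, `(37, θ - 31)`, `(41, θ - 19)`, `(43, θ - 6)` are the only
primes `P` above them with `p ^ {f_P} ≤ 58`. [folklore] -/
theorem eq_span_pair_of_unique_root_seventeen (hθ : aeval θ (csPoly 17) = 0) (h3 : finrank ℚ K = 3)
    {p : ℕ} {c₀ : ℤ}
    (hp : (p = 13 ∧ c₀ = 5) ∨ (p = 17 ∧ c₀ = 5) ∨ (p = 19 ∧ c₀ = 11) ∨ (p = 23 ∧ c₀ = 12) ∨ (p = 31 ∧ c₀ = 20) ∨ (p = 37 ∧ c₀ = 31) ∨ (p = 41 ∧ c₀ = 19) ∨ (p = 43 ∧ c₀ = 6))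
    {P : Ideal (𝓞 K)} (hP : P ∈ primesOver (span {(p : ℤ)}) (𝓞 K)) (hle : p ^ P.inertiaDeg ℤ ≤ 58) :
    P = span {(p : 𝓞 K), thetaInt hθ - (c₀ : 𝓞 K)} := by
  rcases hp with ⟨rfl, rfl⟩ | ⟨rfl, rfl⟩ | ⟨rfl, rfl⟩ | ⟨rfl, rfl⟩ | ⟨rfl, rfl⟩ | ⟨rfl, rfl⟩ | ⟨rfl, rfl⟩ | ⟨rfl, rfl⟩
  · exact eq_span_pair_of_unique_root_of_sq hθ h3 csDisc_seventeen_sq (by norm_num) hP hle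
      (by decide) (by norm_num)
  · exact eq_span_pair_of_unique_root_of_sq hθ h3 csDisc_seventeen_sq (by norm_num) hP hle
      (by decide) (by norm_num)
  · exact eq_span_pair_of_unique_root_of_sq hθ h3 csDisc_seventeen_sq (by norm_num) hP hle
      (by decide) (by norm_num)
  · exact eq_span_pair_of_unique_root_of_sq hθ h3 csDisc_seventeen_sq (by norm_num) hP hle
      (by decide) (by norm_num)
  · exact eq_span_pair_of_unique_root_of_sq hθ h3 csDisc_seventeen_sq (by norm_num) hP hle
      (by decide) (by norm_num)
  · exact eq_span_pair_of_unique_root_of_sq hθ h3 csDisc_seventeen_sq (by norm_num) hP hle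
      (by decide) (by norm_num)
  · exact eq_span_pair_of_unique_root_of_sq hθ h3 csDisc_seventeen_sq (by norm_num) hP hle
      (by decide) (by norm_num)
  · exact eq_span_pair_of_unique_root_of_sq hθ h3 csDisc_seventeen_sq (by norm_num) hP hle
      (by decide) (by norm_num)

/-- `f₁₇ = (x - 4)(x^2 + 2 * x + 4) + 5(-3 * x^2 + 4 * x + 3)`: the factorisation modulo `5`. [folklore] -/
theorem csPoly_seventeen_eq_five :
    csPoly 17 = (X - 4) * (X ^ 2 + 2 * X + 4) + 5 * (-3 * X ^ 2 + 4 * X + 3) := by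
  simp only [csPoly, map_sub, map_one, map_ofNat]
  ring

set_option linter.unusedSimpArgs false in
/-- The lift `X ^ 2 + 2 * X + 4` reduces modulo `5` to the same expression in `𝔽₅[x]`. [folklore] -/
theorem map_quad_seventeen_five :
    (X ^ 2 + 2 * X + 4 : ℤ[X]).map (Int.castRingHom (ZMod 5)) = X ^ 2 + 2 * X + 4 := by
  simp only [Polynomial.map_add, Polynomial.map_sub, Polynomial.map_neg, Polynomial.map_mul, Polynomial.map_pow,
    map_X, Polynomial.map_ofNat, Polynomial.map_one]

set_option linter.unusedSimpArgs false in
/-- `f₁₇ mod 5 = (x - 4)·(X ^ 2 + 2 * X + 4)`. [folklore] -/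
theorem csPolyMod_seventeen_five :
    csPolyMod 17 5 = (X - C ((4 : ℤ) : ZMod 5)) *
      (X ^ 2 + 2 * X + 4 : ℤ[X]).map (Int.castRingHom (ZMod 5)) := by
  rw [csPolyMod, csPoly_seventeen_eq_five, Polynomial.map_add]
  have hp : Polynomial.map (Int.castRingHom (ZMod 5)) (5 * (-3 * X ^ 2 + 4 * X + 3) : ℤ[X]) = 0 := by
    rw [Polynomial.map_mul, show (5 : ℤ[X]) = C 5 from rfl, Polynomial.map_C]
    have : (Int.castRingHom (ZMod 5)) 5 = 0 := by decide
    rw [this, C_0, zero_mul]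
  rw [hp, add_zero, map_quad_seventeen_five]
  simp only [Polynomial.map_mul, Polynomial.map_sub, Polynomial.map_add, Polynomial.map_neg, Polynomial.map_pow,
    map_X, Polynomial.map_ofNat, Polynomial.map_one, Int.cast_ofNat, map_ofNat]

/-- `X ^ 2 + 2 * X + 4` is monic over `𝔽₅`. [folklore] -/
theorem monic_quad_seventeen_five :
    ((X ^ 2 + 2 * X + 4 : ℤ[X]).map (Int.castRingHom (ZMod 5))).Monic := by
  rw [map_quad_seventeen_five]
  monicity!

/-- `X ^ 2 + 2 * X + 4` has no root modulo `5`. [folklore] -/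
theorem quad_seventeen_five_ne_zero : ∀ c : ZMod 5, c ^ 2 + 2 * c + 4 ≠ 0 := by
  decide

/-- `X ^ 2 + 2 * X + 4` is irreducible over `𝔽₅`. [folklore] -/
theorem irreducible_quad_seventeen_five :
    Irreducible ((X ^ 2 + 2 * X + 4 : ℤ[X]).map (Int.castRingHom (ZMod 5))) := by
  haveI := Fact.mk (show Nat.Prime 5 by norm_num)
  rw [map_quad_seventeen_five]
  have hdeg : (X ^ 2 + 2 * X + 4 : (ZMod 5)[X]).natDegree = 2 := by compute_degree!
  refine irreducible_of_degree_le_three_of_not_isRoot (by rw [hdeg]; decide) fun c hc =>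
    quad_seventeen_five_ne_zero c ?_
  have h := hc
  rw [IsRoot.def] at h
  simpa using h

set_option linter.unusedSimpArgs false in
/-- **The primes above `5`**: `(5, θ - 4)` (degree one) and `(5, θ ^ 2 + 2 * θ + 4)` (degree two). [folklore] -/
theorem eq_P5_or_eq_Q5_seventeen (hθ : aeval θ (csPoly 17) = 0) (h3 : finrank ℚ K = 3)
    {P : Ideal (𝓞 K)} (hP : P ∈ primesOver (span {((5 : ℕ) : ℤ)}) (𝓞 K)) :
    P = span {(5 : 𝓞 K), thetaInt hθ - 4} ∨
      P = span {(5 : 𝓞 K), thetaInt hθ ^ 2 + 2 * thetaInt hθ + 4} := by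
  rcases eq_span_pair_of_linear_mul_quadratic_of_sq hθ h3 csDisc_seventeen_sq (by norm_num)
    monic_quad_seventeen_five irreducible_quad_seventeen_five csPolyMod_seventeen_five hP with h | h
  · left; simpa using h
  · right
    simp only [map_add, map_sub, map_neg, map_mul, map_pow, aeval_X, map_ofNat, map_one] at h
    simpa using h

/-- `f₁₇ = (x - 6)(x^2 + 3 * x + 6) + 7(-2 * x^2 + 4 * x + 5)`: the factorisation modulo `7`. [folklore] -/
theorem csPoly_seventeen_eq_seven :
    csPoly 17 = (X - 6) * (X ^ 2 + 3 * X + 6) + 7 * (-2 * X ^ 2 + 4 * X + 5) := by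
  simp only [csPoly, map_sub, map_one, map_ofNat]
  ring

set_option linter.unusedSimpArgs false in
/-- The lift `X ^ 2 + 3 * X + 6` reduces modulo `7` to the same expression in `𝔽₇[x]`. [folklore] -/
theorem map_quad_seventeen_seven :
    (X ^ 2 + 3 * X + 6 : ℤ[X]).map (Int.castRingHom (ZMod 7)) = X ^ 2 + 3 * X + 6 := by
  simp only [Polynomial.map_add, Polynomial.map_sub, Polynomial.map_neg, Polynomial.map_mul, Polynomial.map_pow,
    map_X, Polynomial.map_ofNat, Polynomial.map_one]

set_option linter.unusedSimpArgs false in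
/-- `f₁₇ mod 7 = (x - 6)·(X ^ 2 + 3 * X + 6)`. [folklore] -/
theorem csPolyMod_seventeen_seven :
    csPolyMod 17 7 = (X - C ((6 : ℤ) : ZMod 7)) *
      (X ^ 2 + 3 * X + 6 : ℤ[X]).map (Int.castRingHom (ZMod 7)) := by
  rw [csPolyMod, csPoly_seventeen_eq_seven, Polynomial.map_add]
  have hp : Polynomial.map (Int.castRingHom (ZMod 7)) (7 * (-2 * X ^ 2 + 4 * X + 5) : ℤ[X]) = 0 := by
    rw [Polynomial.map_mul, show (7 : ℤ[X]) = C 7 from rfl, Polynomial.map_C]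
    have : (Int.castRingHom (ZMod 7)) 7 = 0 := by decide
    rw [this, C_0, zero_mul]
  rw [hp, add_zero, map_quad_seventeen_seven]
  simp only [Polynomial.map_mul, Polynomial.map_sub, Polynomial.map_add, Polynomial.map_neg, Polynomial.map_pow,
    map_X, Polynomial.map_ofNat, Polynomial.map_one, Int.cast_ofNat, map_ofNat]

/-- `X ^ 2 + 3 * X + 6` is monic over `𝔽₇`. [folklore] -/
theorem monic_quad_seventeen_seven :
    ((X ^ 2 + 3 * X + 6 : ℤ[X]).map (Int.castRingHom (ZMod 7))).Monic := by
  rw [map_quad_seventeen_seven]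
  monicity!

/-- `X ^ 2 + 3 * X + 6` has no root modulo `7`. [folklore] -/
theorem quad_seventeen_seven_ne_zero : ∀ c : ZMod 7, c ^ 2 + 3 * c + 6 ≠ 0 := by
  decide

/-- `X ^ 2 + 3 * X + 6` is irreducible over `𝔽₇`. [folklore] -/
theorem irreducible_quad_seventeen_seven :
    Irreducible ((X ^ 2 + 3 * X + 6 : ℤ[X]).map (Int.castRingHom (ZMod 7))) := by
  haveI := Fact.mk (show Nat.Prime 7 by norm_num)
  rw [map_quad_seventeen_seven]
  have hdeg : (X ^ 2 + 3 * X + 6 : (ZMod 7)[X]).natDegree = 2 := by compute_degree!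
  refine irreducible_of_degree_le_three_of_not_isRoot (by rw [hdeg]; decide) fun c hc =>
    quad_seventeen_seven_ne_zero c ?_
  have h := hc
  rw [IsRoot.def] at h
  simpa using h

set_option linter.unusedSimpArgs false in
/-- **The primes above `7`**: `(7, θ - 6)` (degree one) and `(7, θ ^ 2 + 3 * θ + 6)` (degree two). [folklore] -/
theorem eq_P7_or_eq_Q7_seventeen (hθ : aeval θ (csPoly 17) = 0) (h3 : finrank ℚ K = 3)
    {P : Ideal (𝓞 K)} (hP : P ∈ primesOver (span {((7 : ℕ) : ℤ)}) (𝓞 K)) :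
    P = span {(7 : 𝓞 K), thetaInt hθ - 6} ∨
      P = span {(7 : 𝓞 K), thetaInt hθ ^ 2 + 3 * thetaInt hθ + 6} := by
  rcases eq_span_pair_of_linear_mul_quadratic_of_sq hθ h3 csDisc_seventeen_sq (by norm_num)
    monic_quad_seventeen_seven irreducible_quad_seventeen_seven csPolyMod_seventeen_seven hP with h | h
  · left; simpa using h
  · right
    simp only [map_add, map_sub, map_neg, map_mul, map_pow, aeval_X, map_ofNat, map_one] at h
    simpa using h

/-- `f₁₇ = (x - 2)(x - 4)(x - 11) + 29(-2 * x + 3)`: `f₁₇ ≡ (x - 2)(x - 4)(x - 11) (mod 29)`. [folklore] -/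
theorem csPoly_seventeen_eq_twentynine :
    csPoly 17 = (X - 2) * (X - 4) * (X - 11) + 29 * (-2 * X + 3) := by
  simp only [csPoly, map_sub, map_one, map_ofNat]
  ring

/-- `f₁₇ mod 29 = (x - 2)(x - 4)(x - 11)`. [folklore] -/
theorem csPolyMod_seventeen_twentynine :
    csPolyMod 17 29 = (X - C ((2 : ℤ) : ZMod 29)) * (X - C ((4 : ℤ) : ZMod 29)) *
      (X - C ((11 : ℤ) : ZMod 29)) := by
  rw [csPolyMod, csPoly_seventeen_eq_twentynine, Polynomial.map_add]
  have hp : Polynomial.map (Int.castRingHom (ZMod 29)) (29 * (-2 * X + 3) : ℤ[X]) = 0 := by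
    rw [Polynomial.map_mul, show (29 : ℤ[X]) = C 29 from rfl, Polynomial.map_C]
    have : (Int.castRingHom (ZMod 29)) 29 = 0 := by decide
    rw [this, C_0, zero_mul]
  rw [hp, add_zero]
  simp only [Polynomial.map_mul, Polynomial.map_sub, map_X, Polynomial.map_ofNat, Int.cast_ofNat,
    map_ofNat]

/-- **The primes above `29`**: `(29, θ - 2)`, `(29, θ - 4)`, `(29, θ - 11)`. [folklore] -/
theorem eq_P29_seventeen (hθ : aeval θ (csPoly 17) = 0) (h3 : finrank ℚ K = 3)
    {P : Ideal (𝓞 K)} (hP : P ∈ primesOver (span {((29 : ℕ) : ℤ)}) (𝓞 K)) :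
    P = span {(29 : 𝓞 K), thetaInt hθ - 2} ∨ P = span {(29 : 𝓞 K), thetaInt hθ - 4} ∨
      P = span {(29 : 𝓞 K), thetaInt hθ - 11} := by
  rcases eq_span_pair_of_split_of_sq hθ h3 csDisc_seventeen_sq (by norm_num)
    csPolyMod_seventeen_twentynine hP with h | h | h
  · left; simpa using h
  · right; left; simpa using h
  · right; right; simpa using h

/-- `f₁₇ = (x - 18)(x - 18)(x - 28) + 47(x^2 - 28 * x + 193)`: `f₁₇ ≡ (x - 18)(x - 18)(x - 28) (mod 47)`. [folklore] -/
theorem csPoly_seventeen_eq_fortyseven :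
    csPoly 17 = (X - 18) * (X - 18) * (X - 28) + 47 * (X ^ 2 - 28 * X + 193) := by
  simp only [csPoly, map_sub, map_one, map_ofNat]
  ring

/-- `f₁₇ mod 47 = (x - 18)(x - 18)(x - 28)`. [folklore] -/
theorem csPolyMod_seventeen_fortyseven :
    csPolyMod 17 47 = (X - C ((18 : ℤ) : ZMod 47)) * (X - C ((18 : ℤ) : ZMod 47)) *
      (X - C ((28 : ℤ) : ZMod 47)) := by
  rw [csPolyMod, csPoly_seventeen_eq_fortyseven, Polynomial.map_add]
  have hp : Polynomial.map (Int.castRingHom (ZMod 47)) (47 * (X ^ 2 - 28 * X + 193) : ℤ[X]) = 0 := by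
    rw [Polynomial.map_mul, show (47 : ℤ[X]) = C 47 from rfl, Polynomial.map_C]
    have : (Int.castRingHom (ZMod 47)) 47 = 0 := by decide
    rw [this, C_0, zero_mul]
  rw [hp, add_zero]
  simp only [Polynomial.map_mul, Polynomial.map_sub, map_X, Polynomial.map_ofNat, Int.cast_ofNat,
    map_ofNat]

/-- **The primes above `47`**: `(47, θ - 18)`, `(47, θ - 18)`, `(47, θ - 28)`. [folklore] -/
theorem eq_P47_seventeen (hθ : aeval θ (csPoly 17) = 0) (h3 : finrank ℚ K = 3)
    {P : Ideal (𝓞 K)} (hP : P ∈ primesOver (span {((47 : ℕ) : ℤ)}) (𝓞 K)) :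
    P = span {(47 : 𝓞 K), thetaInt hθ - 18} ∨ P = span {(47 : 𝓞 K), thetaInt hθ - 18} ∨
      P = span {(47 : 𝓞 K), thetaInt hθ - 28} := by
  rcases eq_span_pair_of_split_of_sq hθ h3 csDisc_seventeen_sq (by norm_num)
    csPolyMod_seventeen_fortyseven hP with h | h | h
  · left; simpa using h
  · right; left; simpa using h
  · right; right; simpa using h

/-! ### Relations among the small primes: explicit generators -/

/-- **`𝔭₅² = (25, θ - 19)`** (`19 ≡ 4 (mod 5)` is the root of `f₁₇` modulo `25`): `θ - 19 = 11·25 + 29·5(θ - 4) - (2θ - 18)(θ - 4)²`. [folklore] -/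
theorem P5_mul_P5_seventeen (hθ : aeval θ (csPoly 17) = 0) :
    span {(5 : 𝓞 K), thetaInt hθ - 4} * span {(5 : 𝓞 K), thetaInt hθ - 4} =
      span {(25 : 𝓞 K), thetaInt hθ - 19} := by
  have rel := thetaInt_rel_seventeen hθ
  set t := thetaInt hθ with ht
  exact span_pair_mul_span_pair_eq_span_pair
    (α₁ := 1) (β₁ := 0)
    (α₂ := 3) (β₂ := 5)
    (α₃ := 3) (β₃ := 5)
    (α₄ := 9) (β₄ := t + 11)
    (u₁ := 1) (u₂ := 0) (u₃ := 0) (u₄ := 0)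
    (v₁ := 11) (v₂ := 29) (v₃ := 0) (v₄ := -2 * t + 18)
    (by ring) (by ring) (by ring) (by ring)
    (by ring) (by linear_combination (2 : 𝓞 K) * rel)

/-- **`𝔭₅ (25, θ - 19) = (4θ - 1)`** (`N(4θ - 1) = -125`; `4θ - 1 = 17·125 + 32·5(θ - 19) + (2θ + 12)(θ - 4)(θ - 19)`): with `𝔭₅² = (25, θ - 19)` this gives `[𝔭₅]³ = 1`. [folklore] -/
theorem P5_mul_P25_seventeen (hθ : aeval θ (csPoly 17) = 0) :
    span {(5 : 𝓞 K), thetaInt hθ - 4} * span {(25 : 𝓞 K), thetaInt hθ - 19} =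
      span {4 * thetaInt hθ - 1} := by
  have rel := thetaInt_rel_seventeen hθ
  set t := thetaInt hθ with ht
  exact span_pair_mul_span_pair_eq_span_singleton
    (δ₁ := -16 * t ^ 2 + 268 * t - 189) (δ₂ := 12 * t ^ 2 - 201 * t + 143)
    (δ₃ := 12 * t ^ 2 - 201 * t + 148) (δ₄ := -9 * t ^ 2 + 151 * t - 112)
    (u₁ := 17) (u₂ := 32) (u₃ := 0) (u₄ := 2 * t + 12)
    (by linear_combination (64 : 𝓞 K) * rel) (by linear_combination (-48 : 𝓞 K) * rel)
    (by linear_combination (-48 : 𝓞 K) * rel) (by linear_combination (36 : 𝓞 K) * rel)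
    (by linear_combination (-2 : 𝓞 K) * rel)

/-- **`𝔭₅ 𝔮₂₅ = (5)`**, `𝔮₂₅ = (5, θ² + 2θ + 4)` the prime of degree two above `5` (`f₁₇ ≡ (x - 4)(x² + 2x + 4) (mod 5)`). [folklore] -/
theorem P5_mul_Q5_seventeen (hθ : aeval θ (csPoly 17) = 0) :
    span {(5 : 𝓞 K), thetaInt hθ - 4} * span {(5 : 𝓞 K), thetaInt hθ ^ 2 + 2 * thetaInt hθ + 4} =
      span {5} := by
  have rel := thetaInt_rel_seventeen hθ
  set t := thetaInt hθ with ht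
  exact span_pair_mul_span_pair_eq_span_singleton
    (δ₁ := 5) (δ₂ := t ^ 2 + 2 * t + 4)
    (δ₃ := t - 4) (δ₄ := 3 * t ^ 2 - 4 * t - 3)
    (u₁ := -42877 * t ^ 2) (u₂ := -1606 * t ^ 2 + 36987 * t) (u₃ := 11098 * t + 1618) (u₄ := 0)
    (by ring) (by ring)
    (by ring) (by linear_combination (1 : 𝓞 K) * rel)
    (by linear_combination (8030 * t - 32365) * rel)

/-- **`𝔭₅ 𝔭₇ = (θ + 1)`** (`N = 35`). [folklore] -/
theorem P5_mul_P7_seventeen (hθ : aeval θ (csPoly 17) = 0) :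
    span {(5 : 𝓞 K), thetaInt hθ - 4} * span {(7 : 𝓞 K), thetaInt hθ - 6} =
      span {thetaInt hθ + 1} := by
  have rel := thetaInt_rel_seventeen hθ
  set t := thetaInt hθ with ht
  exact span_pair_mul_span_pair_eq_span_singleton
    (δ₁ := t ^ 2 - 18 * t + 34) (δ₂ := -t ^ 2 + 18 * t - 29)
    (δ₃ := -t ^ 2 + 18 * t - 27) (δ₄ := t ^ 2 - 17 * t + 23)
    (u₁ := 1) (u₂ := 3) (u₃ := -2) (u₄ := 0)
    (by linear_combination (-1 : 𝓞 K) * rel) (by linear_combination (1 : 𝓞 K) * rel)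
    (by linear_combination (1 : 𝓞 K) * rel) (by linear_combination (-1 : 𝓞 K) * rel)
    (by ring)

/-- **`𝔭₇ 𝔮₄₉ = (7)`**, `𝔮₄₉ = (7, θ² + 3θ + 6)` the prime of degree two above `7` (`f₁₇ ≡ (x - 6)(x² + 3x + 6) (mod 7)`). [folklore] -/
theorem P7_mul_Q7_seventeen (hθ : aeval θ (csPoly 17) = 0) :
    span {(7 : 𝓞 K), thetaInt hθ - 6} * span {(7 : 𝓞 K), thetaInt hθ ^ 2 + 3 * thetaInt hθ + 6} =
      span {7} := by
  have rel := thetaInt_rel_seventeen hθ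
  set t := thetaInt hθ with ht
  exact span_pair_mul_span_pair_eq_span_singleton
    (δ₁ := 7) (δ₂ := t ^ 2 + 3 * t + 6)
    (δ₃ := t - 6) (δ₄ := 2 * t ^ 2 - 4 * t - 5)
    (u₁ := 35200 * t ^ 2) (u₂ := 10 * t ^ 2 - 13399 * t) (u₃ := 23560 * t) (u₄ := -2640)
    (by ring) (by ring)
    (by ring) (by linear_combination (1 : 𝓞 K) * rel)
    (by linear_combination (-70 * t + 95033) * rel)

/-- **`𝔭₅ 𝔭₁₃ = (3θ - 2)`** (`N = -65`). [folklore] -/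
theorem P5_mul_P13_seventeen (hθ : aeval θ (csPoly 17) = 0) :
    span {(5 : 𝓞 K), thetaInt hθ - 4} * span {(13 : 𝓞 K), thetaInt hθ - 5} =
      span {3 * thetaInt hθ - 2} := by
  have rel := thetaInt_rel_seventeen hθ
  set t := thetaInt hθ with ht
  exact span_pair_mul_span_pair_eq_span_singleton
    (δ₁ := -9 * t ^ 2 + 147 * t - 46) (δ₂ := 3 * t ^ 2 - 49 * t + 17)
    (δ₃ := 6 * t ^ 2 - 98 * t + 35) (δ₄ := -2 * t ^ 2 + 33 * t - 13)
    (u₁ := 0) (u₂ := -2) (u₃ := 1) (u₄ := 0)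
    (by linear_combination (27 : 𝓞 K) * rel) (by linear_combination (-9 : 𝓞 K) * rel)
    (by linear_combination (-18 : 𝓞 K) * rel) (by linear_combination (6 : 𝓞 K) * rel)
    (by ring)

/-- **`𝔭₇ 𝔭₁₇ = (4θ - 3)`** (`N = -119`). [folklore] -/
theorem P7_mul_P17_seventeen (hθ : aeval θ (csPoly 17) = 0) :
    span {(7 : 𝓞 K), thetaInt hθ - 6} * span {(17 : 𝓞 K), thetaInt hθ - 5} =
      span {4 * thetaInt hθ - 3} := by
  have rel := thetaInt_rel_seventeen hθ
  set t := thetaInt hθ with ht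
  exact span_pair_mul_span_pair_eq_span_singleton
    (δ₁ := -16 * t ^ 2 + 260 * t - 61) (δ₂ := 4 * t ^ 2 - 65 * t + 17)
    (δ₃ := 12 * t ^ 2 - 195 * t + 50) (δ₄ := -3 * t ^ 2 + 49 * t - 14)
    (u₁ := 0) (u₂ := 3) (u₃ := -1) (u₄ := 0)
    (by linear_combination (64 : 𝓞 K) * rel) (by linear_combination (-16 : 𝓞 K) * rel)
    (by linear_combination (-48 : 𝓞 K) * rel) (by linear_combination (12 : 𝓞 K) * rel)
    (by ring)

/-- **`𝔭₅ 𝔭₁₉ = (2θ - 3)`** (`N = 95`). [folklore] -/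
theorem P5_mul_P19_seventeen (hθ : aeval θ (csPoly 17) = 0) :
    span {(5 : 𝓞 K), thetaInt hθ - 4} * span {(19 : 𝓞 K), thetaInt hθ - 11} =
      span {2 * thetaInt hθ - 3} := by
  have rel := thetaInt_rel_seventeen hθ
  set t := thetaInt hθ with ht
  exact span_pair_mul_span_pair_eq_span_singleton
    (δ₁ := 4 * t ^ 2 - 62 * t - 29) (δ₂ := -2 * t ^ 2 + 31 * t + 17)
    (δ₃ := -2 * t ^ 2 + 31 * t + 24) (δ₄ := t ^ 2 - 15 * t - 14)
    (u₁ := 3) (u₂ := 8) (u₃ := -2) (u₄ := 0)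
    (by linear_combination (-8 : 𝓞 K) * rel) (by linear_combination (4 : 𝓞 K) * rel)
    (by linear_combination (4 : 𝓞 K) * rel) (by linear_combination (-2 : 𝓞 K) * rel)
    (by ring)

/-- **`𝔭₂₃ = (23, θ - 12) = (2θ - 1)` is principal** (`N(2θ - 1) = -23`). [folklore] -/
theorem P23_eq_seventeen (hθ : aeval θ (csPoly 17) = 0) :
    span {(23 : 𝓞 K), thetaInt hθ - 12} = span {2 * thetaInt hθ - 1} := by
  have rel := thetaInt_rel_seventeen hθ
  set t := thetaInt hθ with ht
  exact span_pair_eq_span_singleton (u := 1) (v := 2) (δ := -4 * t ^ 2 + 66 * t - 31)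
    (ε := 2 * t ^ 2 - 33 * t + 16)
    (by ring) (by linear_combination (8 : 𝓞 K) * rel) (by linear_combination (-4 : 𝓞 K) * rel)

/-- **`(29, θ - 2) = (θ - 2)` is principal** (`N(θ - 2) = 29`). [folklore] -/
theorem P29a_eq_seventeen (hθ : aeval θ (csPoly 17) = 0) :
    span {(29 : 𝓞 K), thetaInt hθ - 2} = span {thetaInt hθ - 2} := by
  have rel := thetaInt_rel_seventeen hθ
  set t := thetaInt hθ with ht
  exact span_pair_eq_span_singleton (u := 0) (v := 1) (δ := t ^ 2 - 15 * t - 14)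
    (ε := 1)
    (by ring) (by linear_combination (-1 : 𝓞 K) * rel) (by ring)

/-- **`𝔭₅ (29, θ - 4) = (θ - 4)`** (`N = 145`). [folklore] -/
theorem P5_mul_P29b_seventeen (hθ : aeval θ (csPoly 17) = 0) :
    span {(5 : 𝓞 K), thetaInt hθ - 4} * span {(29 : 𝓞 K), thetaInt hθ - 4} =
      span {thetaInt hθ - 4} := by
  have rel := thetaInt_rel_seventeen hθ
  set t := thetaInt hθ with ht
  exact span_pair_mul_span_pair_eq_span_singleton
    (δ₁ := t ^ 2 - 13 * t - 36) (δ₂ := 5)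
    (δ₃ := 29) (δ₄ := t - 4)
    (u₁ := 0) (u₂ := 6) (u₃ := -1) (u₄ := 0)
    (by linear_combination (-1 : 𝓞 K) * rel) (by ring)
    (by ring) (by ring)
    (by ring)

/-- **`𝔭₇ (29, θ - 11) = (3θ - 4)`** (`N = 203`). [folklore] -/
theorem P7_mul_P29c_seventeen (hθ : aeval θ (csPoly 17) = 0) :
    span {(7 : 𝓞 K), thetaInt hθ - 6} * span {(29 : 𝓞 K), thetaInt hθ - 11} =
      span {3 * thetaInt hθ - 4} := by
  have rel := thetaInt_rel_seventeen hθ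
  set t := thetaInt hθ with ht
  exact span_pair_mul_span_pair_eq_span_singleton
    (δ₁ := 9 * t ^ 2 - 141 * t - 44) (δ₂ := -3 * t ^ 2 + 47 * t + 17)
    (δ₃ := -6 * t ^ 2 + 94 * t + 39) (δ₄ := 2 * t ^ 2 - 31 * t - 15)
    (u₁ := -2) (u₂ := -12) (u₃ := 3) (u₄ := 0)
    (by linear_combination (-27 : 𝓞 K) * rel) (by linear_combination (9 : 𝓞 K) * rel)
    (by linear_combination (18 : 𝓞 K) * rel) (by linear_combination (-6 : 𝓞 K) * rel)
    (by ring)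

/-- **`𝔭₅ 𝔭₃₁ = (θ² - 3θ + 1)`** (`N = -155`). [folklore] -/
theorem P5_mul_P31_seventeen (hθ : aeval θ (csPoly 17) = 0) :
    span {(5 : 𝓞 K), thetaInt hθ - 4} * span {(31 : 𝓞 K), thetaInt hθ - 20} =
      span {thetaInt hθ ^ 2 - 3 * thetaInt hθ + 1} := by
  have rel := thetaInt_rel_seventeen hθ
  set t := thetaInt hθ with ht
  exact span_pair_mul_span_pair_eq_span_singleton
    (δ₁ := 27 * t ^ 2 - 446 * t + 223) (δ₂ := -17 * t ^ 2 + 281 * t - 143)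
    (δ₃ := -19 * t ^ 2 + 315 * t - 173) (δ₄ := 12 * t ^ 2 - 199 * t + 111)
    (u₁ := -1) (u₂ := -2) (u₃ := 1) (u₄ := 1)
    (by linear_combination (-27 * t + 68) * rel) (by linear_combination (17 * t - 43) * rel)
    (by linear_combination (19 * t - 49) * rel) (by linear_combination (-12 * t + 31) * rel)
    (by ring)

/-- **`𝔭₇ 𝔭₃₇ = (6θ - 1)`** (`N = -259`). [folklore] -/
theorem P7_mul_P37_seventeen (hθ : aeval θ (csPoly 17) = 0) :
    span {(7 : 𝓞 K), thetaInt hθ - 6} * span {(37 : 𝓞 K), thetaInt hθ - 31} =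
      span {6 * thetaInt hθ - 1} := by
  have rel := thetaInt_rel_seventeen hθ
  set t := thetaInt hθ with ht
  exact span_pair_mul_span_pair_eq_span_singleton
    (δ₁ := -36 * t ^ 2 + 606 * t - 475) (δ₂ := 30 * t ^ 2 - 505 * t + 397)
    (δ₃ := 30 * t ^ 2 - 505 * t + 402) (δ₄ := -25 * t ^ 2 + 421 * t - 336)
    (u₁ := -10) (u₂ := -15) (u₃ := 3) (u₄ := 0)
    (by linear_combination (216 : 𝓞 K) * rel) (by linear_combination (-180 : 𝓞 K) * rel)
    (by linear_combination (-180 : 𝓞 K) * rel) (by linear_combination (150 : 𝓞 K) * rel)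
    (by ring)

/-- **`𝔭₇ 𝔭₄₁ = (θ² - 4θ + 2)`** (`N = -287`). [folklore] -/
theorem P7_mul_P41_seventeen (hθ : aeval θ (csPoly 17) = 0) :
    span {(7 : 𝓞 K), thetaInt hθ - 6} * span {(41 : 𝓞 K), thetaInt hθ - 19} =
      span {thetaInt hθ ^ 2 - 4 * thetaInt hθ + 2} := by
  have rel := thetaInt_rel_seventeen hθ
  set t := thetaInt hθ with ht
  exact span_pair_mul_span_pair_eq_span_singleton
    (δ₁ := 38 * t ^ 2 - 621 * t + 207) (δ₂ := -17 * t ^ 2 + 278 * t - 95)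
    (δ₃ := -29 * t ^ 2 + 475 * t - 172) (δ₄ := 13 * t ^ 2 - 213 * t + 79)
    (u₁ := 1) (u₂ := 3) (u₃ := 0) (u₄ := 1)
    (by linear_combination (-38 * t + 127) * rel) (by linear_combination (17 * t - 57) * rel)
    (by linear_combination (29 * t - 98) * rel) (by linear_combination (-13 * t + 44) * rel)
    (by ring)

/-- **`𝔭₇ 𝔭₄₃ = (θ - 6)`** (`N = 301`). [folklore] -/
theorem P7_mul_P43_seventeen (hθ : aeval θ (csPoly 17) = 0) :
    span {(7 : 𝓞 K), thetaInt hθ - 6} * span {(43 : 𝓞 K), thetaInt hθ - 6} =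
      span {thetaInt hθ - 6} := by
  have rel := thetaInt_rel_seventeen hθ
  set t := thetaInt hθ with ht
  exact span_pair_mul_span_pair_eq_span_singleton
    (δ₁ := t ^ 2 - 11 * t - 50) (δ₂ := 7)
    (δ₃ := 43) (δ₄ := t - 6)
    (u₁ := 0) (u₂ := -6) (u₃ := 1) (u₄ := 0)
    (by linear_combination (-1 : 𝓞 K) * rel) (by ring)
    (by ring) (by ring)
    (by ring)

/-- **`𝔭₁₃ (47, θ - 18) = (θ - 18)`** (`N = 611 = 13·47`; `47 ∣ Δ` ramifies, `f₁₇ ≡ (x - 18)²(x - 28) (mod 47)`). [folklore] -/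
theorem P13_mul_P47a_seventeen (hθ : aeval θ (csPoly 17) = 0) :
    span {(13 : 𝓞 K), thetaInt hθ - 5} * span {(47 : 𝓞 K), thetaInt hθ - 18} =
      span {thetaInt hθ - 18} := by
  have rel := thetaInt_rel_seventeen hθ
  set t := thetaInt hθ with ht
  exact span_pair_mul_span_pair_eq_span_singleton
    (δ₁ := -t ^ 2 - t - 34) (δ₂ := 13)
    (δ₃ := -t ^ 2 - t + 13) (δ₄ := t - 5)
    (u₁ := -5) (u₂ := -18) (u₃ := 5) (u₄ := 0)
    (by linear_combination (1 : 𝓞 K) * rel) (by ring)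
    (by linear_combination (1 : 𝓞 K) * rel) (by ring)
    (by ring)

/-- **`𝔭₃₁ (47, θ - 28) = (2θ - 9)`** (`N = 1457 = 31·47`). [folklore] -/
theorem P31_mul_P47b_seventeen (hθ : aeval θ (csPoly 17) = 0) :
    span {(31 : 𝓞 K), thetaInt hθ - 20} * span {(47 : 𝓞 K), thetaInt hθ - 28} =
      span {2 * thetaInt hθ - 9} := by
  have rel := thetaInt_rel_seventeen hθ
  set t := thetaInt hθ with ht
  exact span_pair_mul_span_pair_eq_span_singleton
    (δ₁ := 4 * t ^ 2 - 50 * t - 161) (δ₂ := -2 * t ^ 2 + 25 * t + 96)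
    (δ₃ := -2 * t ^ 2 + 25 * t + 104) (δ₄ := t ^ 2 - 12 * t - 62)
    (u₁ := -1) (u₂ := -6) (u₃ := 4) (u₄ := 0)
    (by linear_combination (-8 : 𝓞 K) * rel) (by linear_combination (4 : 𝓞 K) * rel)
    (by linear_combination (4 : 𝓞 K) * rel) (by linear_combination (-2 : 𝓞 K) * rel)
    (by ring)


/-! ### Every ideal class is `1`, `[𝔭₅]` or `[𝔭₇] = [𝔭₅]²` -/

/-- `𝔭₅ = (5, θ - 4)` is a nonzero ideal. [folklore] -/
theorem P5_mem_nonZeroDivisors_seventeen (hθ : aeval θ (csPoly 17) = 0) :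
    span {(5 : 𝓞 K), thetaInt hθ - 4} ∈ (Ideal (𝓞 K))⁰ := by
  have h := span_pair_natCast_mem_nonZeroDivisors (K := K) (n := 5) (Nat.succ_ne_zero 4)
    (thetaInt hθ - 4)
  simp only [Nat.cast_ofNat] at h
  exact h

/-- `𝔭₇ = (7, θ - 6)` is a nonzero ideal. [folklore] -/
theorem P7_mem_nonZeroDivisors_seventeen (hθ : aeval θ (csPoly 17) = 0) :
    span {(7 : 𝓞 K), thetaInt hθ - 6} ∈ (Ideal (𝓞 K))⁰ := by
  have h := span_pair_natCast_mem_nonZeroDivisors (K := K) (n := 7) (Nat.succ_ne_zero 6)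
    (thetaInt hθ - 6)
  simp only [Nat.cast_ofNat] at h
  exact h

/-- **Every ideal class of the trace `17` field is `1`, `[𝔭₅]` or `[𝔭₇]`, with `[𝔭₅]³ = 1` and
`[𝔭₇] = [𝔭₅]⁻¹`** (class number `≤ 3`). Proof: `d_K = 42817`, `⌊M_K⌋ ≤ 58`; Dedekind–Kummer at
`p ≤ 58` (`47 ∣ Δ` ramifies, `29` splits) and the relations listed in the module docstring. [cite: KimYamada2023, §6.1 (proof of Thm. B)] -/
theorem classGroup_mem_triple_seventeen (hθ : aeval θ (csPoly 17) = 0) (h3 : finrank ℚ K = 3)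
    (C : ClassGroup (𝓞 K)) :
    C = 1 ∨ C = ClassGroup.mk0 ⟨span {(5 : 𝓞 K), thetaInt hθ - 4}, P5_mem_nonZeroDivisors_seventeen hθ⟩ ∨
      C = ClassGroup.mk0 ⟨span {(7 : 𝓞 K), thetaInt hθ - 6}, P7_mem_nonZeroDivisors_seventeen hθ⟩ := by
  classical
  set c5 : ClassGroup (𝓞 K) :=
    ClassGroup.mk0 ⟨span {(5 : 𝓞 K), thetaInt hθ - 4}, P5_mem_nonZeroDivisors_seventeen hθ⟩ with hc5
  have rel := thetaInt_rel_seventeen hθ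
  set t := thetaInt hθ with ht
  have hne : ∀ (x y : 𝓞 K) (n : ℕ), x * y = n → n ≠ 0 → x ≠ 0 := by
    rintro x y n hxy hn rfl
    rw [zero_mul] at hxy
    exact hn (by exact_mod_cast hxy.symm)
  have hne1 : t - 19 ≠ 0 :=
    hne _ (-t ^ 2 - 2 * t - 54) 1025 (by push_cast; linear_combination (-1 : 𝓞 K) * rel)
      (by norm_num)
  have hne2 : 4 * t - 1 ≠ 0 :=
    hne _ (-16 * t ^ 2 + 268 * t - 189) 125 (by push_cast; linear_combination (-64 : 𝓞 K) * rel)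
      (by norm_num)
  have hne3 : t + 1 ≠ 0 :=
    hne _ (t ^ 2 - 18 * t + 34) 35 (by push_cast; linear_combination (1 : 𝓞 K) * rel)
      (by norm_num)
  have hne4 : 3 * t - 2 ≠ 0 :=
    hne _ (-9 * t ^ 2 + 147 * t - 46) 65 (by push_cast; linear_combination (-27 : 𝓞 K) * rel)
      (by norm_num)
  have hne5 : 4 * t - 3 ≠ 0 :=
    hne _ (-16 * t ^ 2 + 260 * t - 61) 119 (by push_cast; linear_combination (-64 : 𝓞 K) * rel)
      (by norm_num)
  have hne6 : 2 * t - 3 ≠ 0 :=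
    hne _ (4 * t ^ 2 - 62 * t - 29) 95 (by push_cast; linear_combination (8 : 𝓞 K) * rel)
      (by norm_num)
  have hne7 : t - 4 ≠ 0 :=
    hne _ (t ^ 2 - 13 * t - 36) 145 (by push_cast; linear_combination (1 : 𝓞 K) * rel)
      (by norm_num)
  have hne8 : 3 * t - 4 ≠ 0 :=
    hne _ (9 * t ^ 2 - 141 * t - 44) 203 (by push_cast; linear_combination (27 : 𝓞 K) * rel)
      (by norm_num)
  have hne9 : t ^ 2 - 3 * t + 1 ≠ 0 :=
    hne _ (27 * t ^ 2 - 446 * t + 223) 155 (by push_cast; linear_combination (27 * t - 68) * rel)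
      (by norm_num)
  have hne10 : 6 * t - 1 ≠ 0 :=
    hne _ (-36 * t ^ 2 + 606 * t - 475) 259 (by push_cast; linear_combination (-216 : 𝓞 K) * rel)
      (by norm_num)
  have hne11 : t ^ 2 - 4 * t + 2 ≠ 0 :=
    hne _ (38 * t ^ 2 - 621 * t + 207) 287 (by push_cast; linear_combination (38 * t - 127) * rel)
      (by norm_num)
  have hne12 : t - 6 ≠ 0 :=
    hne _ (t ^ 2 - 11 * t - 50) 301 (by push_cast; linear_combination (1 : 𝓞 K) * rel)
      (by norm_num)
  have hne13 : t - 18 ≠ 0 :=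
    hne _ (-t ^ 2 - t - 34) 611 (by push_cast; linear_combination (-1 : 𝓞 K) * rel)
      (by norm_num)
  have hne14 : 2 * t - 9 ≠ 0 :=
    hne _ (4 * t ^ 2 - 50 * t - 161) 1457 (by push_cast; linear_combination (8 : 𝓞 K) * rel)
      (by norm_num)
  let H : Subgroup (ClassGroup (𝓞 K)) := Subgroup.zpowers c5
  have hc5H : c5 ∈ H := Subgroup.mem_zpowers c5
  have hinv : ∀ (P Q : Ideal (𝓞 K)) (hP0 : P ∈ (Ideal (𝓞 K))⁰) (hQ0 : Q ∈ (Ideal (𝓞 K))⁰) (x : 𝓞 K),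
      x ≠ 0 → P * Q = span {x} → ClassGroup.mk0 ⟨P, hP0⟩ = (ClassGroup.mk0 ⟨Q, hQ0⟩)⁻¹ := by
    intro P Q hP0 hQ0 x hx hPQ
    exact ClassGroup.mk0_eq_mk0_inv_iff.mpr ⟨x, hx, by simpa using hPQ⟩
  have hprinc : ∀ (P : Ideal (𝓞 K)) (hP0 : P ∈ (Ideal (𝓞 K))⁰) (x : 𝓞 K), P = span {x} →
      ClassGroup.mk0 ⟨P, hP0⟩ ∈ H := by
    intro P hP0 x hPx
    have : ClassGroup.mk0 ⟨P, hP0⟩ = 1 :=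
      (ClassGroup.mk0_eq_one_iff hP0).mpr ⟨⟨x, by rw [hPx, submodule_span_eq]⟩⟩
    rw [this]
    exact H.one_mem
  have hnz : ∀ (n : ℕ) (hn : n ≠ 0) (x : 𝓞 K), span {(n : 𝓞 K), x} ∈ (Ideal (𝓞 K))⁰ :=
    fun n hn x => span_pair_natCast_mem_nonZeroDivisors (K := K) hn x
  have hP5 : span {(5 : 𝓞 K), t - 4} ∈ (Ideal (𝓞 K))⁰ := P5_mem_nonZeroDivisors_seventeen hθ
  have hP7 : span {(7 : 𝓞 K), t - 6} ∈ (Ideal (𝓞 K))⁰ := P7_mem_nonZeroDivisors_seventeen hθ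
  have hP25 : span {(25 : 𝓞 K), t - 19} ∈ (Ideal (𝓞 K))⁰ := by
    have h := hnz 25 (by norm_num) (t - 19)
    simp only [Nat.cast_ofNat] at h
    exact h
  have hP13 : span {(13 : 𝓞 K), t - 5} ∈ (Ideal (𝓞 K))⁰ := by
    have h := hnz 13 (by norm_num) (t - 5)
    simp only [Nat.cast_ofNat] at h
    exact h
  have hP31 : span {(31 : 𝓞 K), t - 20} ∈ (Ideal (𝓞 K))⁰ := by
    have h := hnz 31 (by norm_num) (t - 20)
    simp only [Nat.cast_ofNat] at h
    exact h
  have hpartner : ∀ (Q : Ideal (𝓞 K)) (hQ0 : Q ∈ (Ideal (𝓞 K))⁰) (x : 𝓞 K), x ≠ 0 →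
      span {(5 : 𝓞 K), t - 4} * Q = span {x} → ClassGroup.mk0 ⟨Q, hQ0⟩ ∈ H := by
    intro Q hQ0 x hx hQ
    rw [hinv Q _ hQ0 hP5 x hx (by rw [mul_comm]; exact hQ)]
    exact H.inv_mem hc5H
  -- `[𝔭₇] = [𝔭₁₃] = [𝔭₃₁] = [𝔭₅]⁻¹`; `[𝔭₅]² = [(25, θ - 19)] = [𝔭₅]⁻¹`, so `[𝔭₅]³ = 1`
  have h7cls : ClassGroup.mk0 ⟨span {(7 : 𝓞 K), t - 6}, hP7⟩ = c5⁻¹ :=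
    hinv _ _ hP7 hP5 _ hne3 (by rw [mul_comm]; exact P5_mul_P7_seventeen hθ)
  have h13cls : ClassGroup.mk0 ⟨span {(13 : 𝓞 K), t - 5}, hP13⟩ = c5⁻¹ :=
    hinv _ _ hP13 hP5 _ hne4 (by rw [mul_comm]; exact P5_mul_P13_seventeen hθ)
  have h31cls : ClassGroup.mk0 ⟨span {(31 : 𝓞 K), t - 20}, hP31⟩ = c5⁻¹ :=
    hinv _ _ hP31 hP5 _ hne9 (by rw [mul_comm]; exact P5_mul_P31_seventeen hθ)
  have h25cls : ClassGroup.mk0 ⟨span {(25 : 𝓞 K), t - 19}, hP25⟩ = c5⁻¹ :=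
    hinv _ _ hP25 hP5 _ hne2 (by rw [mul_comm]; exact P5_mul_P25_seventeen hθ)
  have hsq : c5 * c5 = c5⁻¹ := by
    rw [← h25cls, hc5, ← map_mul]
    congr 1
    exact Subtype.ext (by simpa using P5_mul_P5_seventeen hθ)
  have hcube : c5 ^ (3 : ℤ) = 1 := by
    rw [show (3 : ℤ) = 2 + 1 by norm_num, zpow_add, zpow_two, zpow_one, hsq, inv_mul_cancel]
  -- Minkowski: `⌊M_K⌋ ≤ 58`
  have hd : ((|NumberField.discr K| : ℤ) : ℝ) ≤ (42817 : ℕ) := by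
    rw [discr_eq_seventeen hθ h3]
    norm_num
  have hfloor := floor_minkowskiBound_le_cubic h3 hd (s := 207) (U := 58) (by norm_num)
    (by norm_num) (by norm_num)
  have htop : H = ⊤ := by
    refine classGroup_subgroup_eq_top_of_primesOver H hfloor fun p hp hprime P hP0 hP hle => ?_
    have hpU : p ≤ 58 := (Finset.mem_Icc.mp hp).2
    have h1p : 1 ≤ p := (Finset.mem_Icc.mp hp).1
    interval_cases p
    · exact absurd hprime (by decide)
    · exact hprinc P hP0 _ (eq_span_of_inert_seventeen hθ h3 (by norm_num) hP)
    · exact hprinc P hP0 _ (eq_span_of_inert_seventeen hθ h3 (by norm_num) hP)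
    · exact absurd hprime (by decide)
    · -- `p = 5`
      rcases eq_P5_or_eq_Q5_seventeen hθ h3 hP with h | h <;> subst h
      · exact hc5H
      · exact hpartner _ hP0 5 (by norm_num) (P5_mul_Q5_seventeen hθ)
    · exact absurd hprime (by decide)
    · -- `p = 7`
      rcases eq_P7_or_eq_Q7_seventeen hθ h3 hP with h | h <;> subst h
      · rw [h7cls]
        exact H.inv_mem hc5H
      · rw [hinv _ _ hP0 hP7 7 (by norm_num) (by rw [mul_comm]; exact P7_mul_Q7_seventeen hθ), h7cls,
          inv_inv]
        exact hc5H
    · exact absurd hprime (by decide)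
    · exact absurd hprime (by decide)
    · exact absurd hprime (by decide)
    · exact hprinc P hP0 _ (eq_span_of_inert_seventeen hθ h3 (by norm_num) hP)
    · exact absurd hprime (by decide)
    · -- `p = 13`
      have h := eq_span_pair_of_unique_root_seventeen hθ h3 (Or.inl ⟨rfl, rfl⟩) hP hle
      simp only [Nat.cast_ofNat, Int.cast_ofNat] at h
      subst h
      exact hpartner _ hP0 _ hne4 (P5_mul_P13_seventeen hθ)
    · exact absurd hprime (by decide)
    · exact absurd hprime (by decide)
    · exact absurd hprime (by decide)
    · -- `p = 17`
      have h := eq_span_pair_of_unique_root_seventeen hθ h3 (Or.inr (Or.inl ⟨rfl, rfl⟩)) hP hle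
      simp only [Nat.cast_ofNat, Int.cast_ofNat] at h
      subst h
      rw [hinv _ _ hP0 hP7 _ hne5 (by rw [mul_comm]; exact P7_mul_P17_seventeen hθ), h7cls, inv_inv]
      exact hc5H
    · exact absurd hprime (by decide)
    · -- `p = 19`
      have h := eq_span_pair_of_unique_root_seventeen hθ h3 (Or.inr (Or.inr (Or.inl ⟨rfl, rfl⟩))) hP hle
      simp only [Nat.cast_ofNat, Int.cast_ofNat] at h
      subst h
      exact hpartner _ hP0 _ hne6 (P5_mul_P19_seventeen hθ)
    · exact absurd hprime (by decide)
    · exact absurd hprime (by decide)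
    · exact absurd hprime (by decide)
    · -- `p = 23`
      have h := eq_span_pair_of_unique_root_seventeen hθ h3 (Or.inr (Or.inr (Or.inr (Or.inl ⟨rfl, rfl⟩)))) hP hle
      simp only [Nat.cast_ofNat, Int.cast_ofNat] at h
      subst h
      exact hprinc _ hP0 _ (P23_eq_seventeen hθ)
    · exact absurd hprime (by decide)
    · exact absurd hprime (by decide)
    · exact absurd hprime (by decide)
    · exact absurd hprime (by decide)
    · exact absurd hprime (by decide)
    · -- `p = 29`
      rcases eq_P29_seventeen hθ h3 hP with h | h | h <;> subst h
      · exact hprinc _ hP0 _ (P29a_eq_seventeen hθ)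
      · exact hpartner _ hP0 _ hne7 (P5_mul_P29b_seventeen hθ)
      · rw [hinv _ _ hP0 hP7 _ hne8 (by rw [mul_comm]; exact P7_mul_P29c_seventeen hθ), h7cls, inv_inv]
        exact hc5H
    · exact absurd hprime (by decide)
    · -- `p = 31`
      have h := eq_span_pair_of_unique_root_seventeen hθ h3 (Or.inr (Or.inr (Or.inr (Or.inr (Or.inl ⟨rfl, rfl⟩))))) hP hle
      simp only [Nat.cast_ofNat, Int.cast_ofNat] at h
      subst h
      exact hpartner _ hP0 _ hne9 (P5_mul_P31_seventeen hθ)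
    · exact absurd hprime (by decide)
    · exact absurd hprime (by decide)
    · exact absurd hprime (by decide)
    · exact absurd hprime (by decide)
    · exact absurd hprime (by decide)
    · -- `p = 37`
      have h := eq_span_pair_of_unique_root_seventeen hθ h3 (Or.inr (Or.inr (Or.inr (Or.inr (Or.inr (Or.inl ⟨rfl, rfl⟩)))))) hP hle
      simp only [Nat.cast_ofNat, Int.cast_ofNat] at h
      subst h
      rw [hinv _ _ hP0 hP7 _ hne10 (by rw [mul_comm]; exact P7_mul_P37_seventeen hθ), h7cls, inv_inv]
      exact hc5H
    · exact absurd hprime (by decide)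
    · exact absurd hprime (by decide)
    · exact absurd hprime (by decide)
    · -- `p = 41`
      have h := eq_span_pair_of_unique_root_seventeen hθ h3 (Or.inr (Or.inr (Or.inr (Or.inr (Or.inr (Or.inr (Or.inl ⟨rfl, rfl⟩))))))) hP hle
      simp only [Nat.cast_ofNat, Int.cast_ofNat] at h
      subst h
      rw [hinv _ _ hP0 hP7 _ hne11 (by rw [mul_comm]; exact P7_mul_P41_seventeen hθ), h7cls, inv_inv]
      exact hc5H
    · exact absurd hprime (by decide)
    · -- `p = 43`
      have h := eq_span_pair_of_unique_root_seventeen hθ h3 (Or.inr (Or.inr (Or.inr (Or.inr (Or.inr (Or.inr (Or.inr (⟨rfl, rfl⟩)))))))) hP hle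
      simp only [Nat.cast_ofNat, Int.cast_ofNat] at h
      subst h
      rw [hinv _ _ hP0 hP7 _ hne12 (by rw [mul_comm]; exact P7_mul_P43_seventeen hθ), h7cls, inv_inv]
      exact hc5H
    · exact absurd hprime (by decide)
    · exact absurd hprime (by decide)
    · exact absurd hprime (by decide)
    · -- `p = 47` (ramified)
      rcases eq_P47_seventeen hθ h3 hP with h | h | h <;> subst h
      · rw [hinv _ _ hP0 hP13 _ hne13 (by rw [mul_comm]; exact P13_mul_P47a_seventeen hθ), h13cls, inv_inv]
        exact hc5H
      · rw [hinv _ _ hP0 hP13 _ hne13 (by rw [mul_comm]; exact P13_mul_P47a_seventeen hθ), h13cls, inv_inv]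
        exact hc5H
      · rw [hinv _ _ hP0 hP31 _ hne14 (by rw [mul_comm]; exact P31_mul_P47b_seventeen hθ), h31cls, inv_inv]
        exact hc5H
    · exact absurd hprime (by decide)
    · exact absurd hprime (by decide)
    · exact absurd hprime (by decide)
    · exact absurd hprime (by decide)
    · exact absurd hprime (by decide)
    · exact hprinc P hP0 _ (eq_span_of_inert_seventeen hθ h3 (by norm_num) hP)
    · exact absurd hprime (by decide)
    · exact absurd hprime (by decide)
    · exact absurd hprime (by decide)
    · exact absurd hprime (by decide)
    · exact absurd hprime (by decide)
  have hC : C ∈ H := by rw [htop]; exact Subgroup.mem_top C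
  obtain ⟨k, rfl⟩ := Subgroup.mem_zpowers_iff.mp hC
  obtain ⟨q, r, hr, rfl⟩ : ∃ q r : ℤ, (r = 0 ∨ r = 1 ∨ r = 2) ∧ k = 3 * q + r :=
    ⟨k / 3, k % 3, by omega, by omega⟩
  rw [zpow_add, zpow_mul, hcube, one_zpow, one_mul]
  rcases hr with rfl | rfl | rfl
  · left
    rw [zpow_zero]
  · right; left
    rw [zpow_one]
  · right; right
    rw [zpow_two, hsq, ← h7cls]


end Field


/-! ### The ideal classes of `ℤ[X]/(f₁₇)` and Gompf's conjecture for the traces `17` and `-12` -/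

section Matrices

/-- **The ideal classes of `ℤ[Θ₁₇] = ℤ[X]/(f₁₇)`**: every non-zero ideal is in the class of
`⟨Θ - 1, 1⟩`, `⟨Θ - 4, 5⟩` or `⟨Θ - 6, 7⟩` (the representatives `(1, 1, 17)`, `(4, 5, 17)`,
`(6, 7, 17)` cover `C(ℤ[Θ₁₇])`). [cite: KimYamada2023, §6.1 (proof of Thm. B)] -/
theorem ideal_class_adjoinRoot_seventeen (J : Ideal (AdjoinRoot (csPoly 17))) (hJ : J ≠ ⊥) :
    ∃ x y : AdjoinRoot (csPoly 17), x ≠ 0 ∧ y ≠ 0 ∧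
      (span {x} * J = span {y} * csIdeal 1 1 17 ∨ span {x} * J = span {y} * csIdeal 4 5 17 ∨
        span {x} * J = span {y} * csIdeal 6 7 17) := by
  classical
  set θ' := AdjoinRoot.root (csPolyQ 17) with hθ'
  have hθ : aeval θ' (csPoly 17) = 0 := aeval_root_csPoly 17
  have h3 : finrank ℚ (CSField 17) = 3 := finrank_CSField 17
  obtain ⟨e, he⟩ := exists_ringEquiv_adjoinRoot_of_sq hθ h3 csDisc_seventeen_sq
  set I : Ideal (𝓞 (CSField 17)) := J.map e with hI
  have hIJ : I.map (e.symm : 𝓞 (CSField 17) →+* AdjoinRoot (csPoly 17)) = J := by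
    rw [hI]
    exact Ideal.map_of_equiv e (I := J)
  have hI0 : I ≠ ⊥ := by
    intro h0
    apply hJ
    rw [← hIJ, h0, Ideal.map_bot]
  have hImem : I ∈ (Ideal (𝓞 (CSField 17)))⁰ := mem_nonZeroDivisors_iff_ne_zero.mpr hI0
  have hsymm : ∀ x, (e.symm : 𝓞 (CSField 17) →+* AdjoinRoot (csPoly 17)) (e x) = x :=
    fun x => e.symm_apply_apply x
  have hP5 : (span {(5 : 𝓞 (CSField 17)), thetaInt hθ - 4}).map
      (e.symm : 𝓞 (CSField 17) →+* AdjoinRoot (csPoly 17)) = csIdeal 4 5 17 := by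
    rw [Ideal.map_span, Set.image_insert_eq, Set.image_singleton, map_sub, ← he, hsymm, map_ofNat,
      map_ofNat, csIdeal, Set.pair_comm]
    simp
  have hP7 : (span {(7 : 𝓞 (CSField 17)), thetaInt hθ - 6}).map
      (e.symm : 𝓞 (CSField 17) →+* AdjoinRoot (csPoly 17)) = csIdeal 6 7 17 := by
    rw [Ideal.map_span, Set.image_insert_eq, Set.image_singleton, map_sub, ← he, hsymm, map_ofNat,
      map_ofNat, csIdeal, Set.pair_comm]
    simp
  have hcase : ∀ (P : Ideal (𝓞 (CSField 17))) (hP0 : P ∈ (Ideal (𝓞 (CSField 17)))⁰)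
      (Q : Ideal (AdjoinRoot (csPoly 17))),
      P.map (e.symm : 𝓞 (CSField 17) →+* AdjoinRoot (csPoly 17)) = Q →
      ClassGroup.mk0 ⟨I, hImem⟩ = ClassGroup.mk0 ⟨P, hP0⟩ →
        ∃ x y : AdjoinRoot (csPoly 17), x ≠ 0 ∧ y ≠ 0 ∧ span {x} * J = span {y} * Q := by
    intro P hP0 Q hPQ hcls
    obtain ⟨x, y, hx, hy, hxy⟩ := ClassGroup.mk0_eq_mk0_iff.mp hcls
    refine ⟨(e.symm : 𝓞 (CSField 17) →+* AdjoinRoot (csPoly 17)) x,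
      (e.symm : 𝓞 (CSField 17) →+* AdjoinRoot (csPoly 17)) y,
      (map_ne_zero_iff _ e.symm.injective).mpr hx, (map_ne_zero_iff _ e.symm.injective).mpr hy, ?_⟩
    have h := congrArg (Ideal.map (e.symm : 𝓞 (CSField 17) →+* AdjoinRoot (csPoly 17))) hxy
    simp only [Ideal.map_mul, Ideal.map_span, Set.image_singleton] at h
    rw [hIJ, hPQ] at h
    exact h
  rcases classGroup_mem_triple_seventeen hθ h3 (ClassGroup.mk0 ⟨I, hImem⟩) with h1 | h5 | h7
  · obtain ⟨z, hz⟩ := ((ClassGroup.mk0_eq_one_iff hImem).mp h1).principal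
    have hz' : I = span {z} := by rw [hz, submodule_span_eq]
    have hz0 : z ≠ 0 := by
      rintro rfl
      apply hI0
      rw [hz', Ideal.span_singleton_eq_bot]
    refine ⟨1, (e.symm : 𝓞 (CSField 17) →+* AdjoinRoot (csPoly 17)) z, one_ne_zero,
      (map_ne_zero_iff _ e.symm.injective).mpr hz0, Or.inl ?_⟩
    rw [Ideal.span_singleton_one, Ideal.top_mul, csIdeal_one_one, Ideal.mul_top, ← hIJ, hz',
      Ideal.map_span, Set.image_singleton]
  · obtain ⟨x, y, hx, hy, h⟩ := hcase _ _ _ hP5 h5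
    exact ⟨x, y, hx, hy, Or.inr (Or.inl h)⟩
  · obtain ⟨x, y, hx, hy, h⟩ := hcase _ _ _ hP7 h7
    exact ⟨x, y, hx, hy, Or.inr (Or.inr h)⟩

/-- `5 ∣ f₁₇(4) = -145`: `(4, 5, 17) ∈ 𝒞𝒮`. [cite: KimYamada2023, §6.1 (proof of Thm. B)] -/
theorem five_dvd_eval_csPoly_seventeen_four : (5 : ℤ) ∣ (csPoly 17).eval 4 := by
  rw [eval_csPoly]; norm_num

/-- `7 ∣ f₁₇(6) = -301`: `(6, 7, 17) ∈ 𝒞𝒮`. [cite: KimYamada2023, §6.1 (proof of Thm. B)] -/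
theorem seven_dvd_eval_csPoly_seventeen_six : (7 : ℤ) ∣ (csPoly 17).eval 6 := by
  rw [eval_csPoly]; norm_num

/-- **Every Cappell–Shaneson matrix of trace `17` is similar to `X_{1,1,17} = A₁₅`, `X_{4,5,17}` or
`X_{6,7,17}`** (Prop. 2.14). [cite: KimYamada2023, §6.1 (proof of Thm. B) and Prop. 2.14] -/
theorem isConj_standardCSMatrix_of_trace_eq_seventeen (A : SL(3, ℤ))
    (hdet : ((A : Matrix (Fin 3) (Fin 3) ℤ) - 1).det = 1)
    (htr : Matrix.trace (A : Matrix (Fin 3) (Fin 3) ℤ) = 17) :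
    IsConj A (standardCSMatrix 1 1 17 (one_dvd _)) ∨
      IsConj A (standardCSMatrix 4 5 17 five_dvd_eval_csPoly_seventeen_four) ∨
      IsConj A (standardCSMatrix 6 7 17 seven_dvd_eval_csPoly_seventeen_six) := by
  have hcover : ∀ J : Ideal (AdjoinRoot (csPoly 17)), J ≠ ⊥ →
      ∃ (c d : ℤ) (_ : d ∣ (csPoly 17).eval c) (x y : AdjoinRoot (csPoly 17)),
        x ≠ 0 ∧ y ≠ 0 ∧ Ideal.span {x} * J = Ideal.span {y} * csIdeal c d 17 ∧
          ((c = 1 ∧ d = 1) ∨ (c = 4 ∧ d = 5) ∨ (c = 6 ∧ d = 7)) := by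
    intro J hJ
    obtain ⟨x, y, hx, hy, hxy⟩ := ideal_class_adjoinRoot_seventeen J hJ
    rcases hxy with h1 | h5 | h7
    · exact ⟨1, 1, one_dvd _, x, y, hx, hy, h1, Or.inl ⟨rfl, rfl⟩⟩
    · exact ⟨4, 5, five_dvd_eval_csPoly_seventeen_four, x, y, hx, hy, h5, Or.inr (Or.inl ⟨rfl, rfl⟩)⟩
    · exact ⟨6, 7, seven_dvd_eval_csPoly_seventeen_six, x, y, hx, hy, h7, Or.inr (Or.inr ⟨rfl, rfl⟩)⟩
  obtain ⟨c, d, h, hconj, hcd⟩ := exists_isConj_standardCSMatrix_of_cover _ hcover A hdet htr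
  rcases hcd with ⟨rfl, rfl⟩ | ⟨rfl, rfl⟩ | ⟨rfl, rfl⟩
  · exact Or.inl hconj
  · exact Or.inr (Or.inl hconj)
  · exact Or.inr (Or.inr hconj)

/-- **Kim–Yamada 2023, Theorem B for the trace `17`, PROVED**: the classes `(4, 5, 17)` and
`(6, 7, 17)` move by Gompf moves to the traces `7 = 17 - 2·5` and `3 = 17 - 2·7`, where Gompf's
conjecture holds (class number one). [cite: KimYamada2023, Thm. B and §6.1] -/
theorem gompfConjectureForTrace_seventeen : GompfConjectureForTrace 17 := by
  intro A hdet htr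
  rcases isConj_standardCSMatrix_of_trace_eq_seventeen A hdet htr with h1 | h5 | h7
  · exact (GompfEquiv.of_isConj h1).trans (gompfEquiv_standardCSMatrix_one_one 15 (one_dvd _))
  · exact (GompfEquiv.of_isConj h5).trans
      (gompfEquiv_standardCSMatrix_akbulutKirbyMatrix_of_modEq
        (gompfConjectureForTrace_of_mem_Icc (by norm_num)) five_dvd_eval_csPoly_seventeen_four
        (show (17 : ℤ) ≡ 7 [ZMOD 5] by decide))
  · exact (GompfEquiv.of_isConj h7).trans
      (gompfEquiv_standardCSMatrix_akbulutKirbyMatrix_of_modEq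
        (gompfConjectureForTrace_of_mem_Icc (by norm_num)) seven_dvd_eval_csPoly_seventeen_six
        (show (17 : ℤ) ≡ 3 [ZMOD 7] by decide))

/-- **Theorem B for the trace `-12`** (`= 5 - 17`), by Theorem A. [cite: KimYamada2023, Thm. A and Thm. B] -/
theorem gompfConjectureForTrace_neg_twelve : GompfConjectureForTrace (-12) := by
  have h := gompfConjectureForTrace_of_five_sub gompfConjectureForTrace_seventeen
  norm_num at h
  exact h

end Matrices


end Literature.Topology.FourManifolds

end
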